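import Summits.CriticalPhenomena.SAWScalingLimit.Theses.SAWTotalPositivity
import Summits.CriticalPhenomena.SAWScalingLimit.Theorems.SAWRenewalTightnessTightOfShellCrossing

/-!
# `SAWTotalPositivity.SAWTraversalBound` (stmt-CriticalPhenomena-1880) is route
`SAWRenewalTightness`'s crux `ShellCrossingBound` (stmt-CriticalPhenomena-4728)

Support file for the statement item `SAWTraversalBound` of route `SAWTotalPositivity` (shared
verbatim with routes `SAWLeftRightFKG`, `SAWTargetMonotonicity`). Route `SAWRenewalTightness`
files the same Aizenman–Burchard hypothesis (H1) for the critical square-lattice SAW as its crux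
`ShellCrossingBound`, with the single textual difference that the constant `K` is not asked to be
nonnegative there. The two are equivalent (`sawTraversalBound_iff_shellCrossingBound`: a negative
`K` only strengthens the bound, and `max K 0` repairs it), so:

* `sawTraversalBound_iff_shellCrossingBound` — items stmt-1880 and stmt-4728 are ONE proposition up
  to `K ↦ max K 0`; a proof of either closes both, and `SurgeryReduction` (stmt-4731) applied to
  `AnnularMassDecay` (stmt-4729) and `TubeLowerBound` (stmt-4730) closes stmt-1880
  (`sawTraversalBound_of_surgeryReduction`).
* `renewalEventualTight_iff_eventualTight` — the two typed forms of eventual tightness of the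
  critical SAW laws in the tree, `SAWRenewalTightness.EventualTight` (stmt-1372: `∃ δ₀`,
  `IsTightMeasureSet` of the push-forward laws over `δ ∈ (0, δ₀]`) and
  `SAWTotalPositivity.EventualTight` (stmt-1881: `IsTightAlongMesh`), are equivalent: `→` is the
  bridge `isTightAlongMesh_of_isTightMeasureSet_image` (the SAW observable is measurable, discrete
  σ-algebra); `←` runs through the certified chain stmt-1881 → stmt-1880
  (`sawTraversalBound_of_eventualTight`) → stmt-4728 → stmt-1372 (`TightOfShellCrossing_proof`, the
  proved Aizenman–Burchard criterion).
* `sawTraversalBound_iff_renewalEventualTight` — hence stmt-1880 ⟺ stmt-1372 as well.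

Together with `sawTraversalBound_iff_eventualTight` (stmt-1880 ⟺ stmt-1881, route `SAWLeftRightFKG`'s
names, definitionally the present route's) the
four open items stmt-1880, stmt-1881, stmt-4728, stmt-1372 of the four SAW tightness routes are
certified to be one and the same proposition: uniform-in-mesh precompactness of the critical planar
self-avoiding walk (Lawler–Schramm–Werner 2004, §3.4.2), open. No named fact is used.
-/

noncomputable section

open MeasureTheory Filter Topology Set Metric
open Literature.Probability.RandomPlanarGeometry Literature.Probability.LatticeModels
open scoped ENNReal unitInterval

namespace Summit.CriticalPhenomena.SAWScalingLimit.Theorems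

open Summit.CriticalPhenomena.SAWScalingLimit.Theses

/-- **stmt-1880 ⟺ stmt-4728.** `SAWTotalPositivity.SAWTraversalBound` (with `0 ≤ K`) and
`SAWRenewalTightness.ShellCrossingBound` (no sign condition on `K`) are equivalent: forgetting the
sign is free, and conversely the bound with constant `K` implies the bound with `max K 0 ≥ 0`
because `(ρ/R)^λ ≥ 0`. [folklore] -/
theorem sawTraversalBound_iff_shellCrossingBound :
    SAWTotalPositivity.SAWTraversalBound ↔ SAWRenewalTightness.ShellCrossingBound := by
  constructor
  · intro h D a b hab
    obtain ⟨k, K, lam, δ₀, -, hlam, hδ₀, hb⟩ := h D a b hab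
    exact ⟨k, K, lam, δ₀, hlam, hδ₀, hb⟩
  · intro h D a b hab
    obtain ⟨k, K, lam, δ₀, hlam, hδ₀, hb⟩ := h D a b hab
    refine ⟨k, max K 0, lam, δ₀, le_max_right _ _, hlam, hδ₀, ?_⟩
    intro δ hδ x ρ R hδρ hρR hR1
    have hρ0 : 0 ≤ ρ := hδ.1.le.trans hδρ
    have hR0 : 0 ≤ R := hρ0.trans hρR.le
    exact (hb δ hδ x ρ R hδρ hρR hR1).trans (ENNReal.ofReal_le_ofReal
      (mul_le_mul_of_nonneg_right (le_max_left _ _) (Real.rpow_nonneg (div_nonneg hρ0 hR0) _)))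

/-- **stmt-1880 from route `SAWRenewalTightness`'s surgery plan**: `SurgeryReduction` (stmt-4731:
`AnnularMassDecay → TubeLowerBound → ShellCrossingBound`) together with its two hypotheses
`AnnularMassDecay` (stmt-4729) and `TubeLowerBound` (stmt-4730) proves `SAWTraversalBound`.
[folklore] -/
theorem sawTraversalBound_of_surgeryReduction (hS : SAWRenewalTightness.SurgeryReduction)
    (hA : SAWRenewalTightness.AnnularMassDecay) (hT : SAWRenewalTightness.TubeLowerBound) :
    SAWTotalPositivity.SAWTraversalBound :=
  sawTraversalBound_iff_shellCrossingBound.2 (hS hA hT)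

/-- **stmt-1372 ⟺ stmt-1881.** The `∃ δ₀, IsTightMeasureSet`-form of eventual tightness of the
critical SAW laws (route `SAWRenewalTightness`) is equivalent to the `IsTightAlongMesh`-form
(routes `SAWTotalPositivity` / `SAWLeftRightFKG` / `SAWParafermion` …). `→`: the bridge
`isTightAlongMesh_of_isTightMeasureSet_image`, the SAW observable `γ ↦ γ.curve` being measurable
at every mesh (`SAW.aemeasurable_curve`). `←`: `EventualTight → SAWTraversalBound`
(`sawTraversalBound_of_eventualTight`, compactness bounds the traversal counts) `→
ShellCrossingBound` (`sawTraversalBound_iff_shellCrossingBound`) `→` stmt-1372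
(`TightOfShellCrossing_proof`, the proved Aizenman–Burchard criterion). [folklore] -/
theorem renewalEventualTight_iff_eventualTight :
    SAWRenewalTightness.EventualTight ↔ SAWTotalPositivity.EventualTight := by
  constructor
  · intro h D a b hab
    obtain ⟨δ₀, hδ₀, hT⟩ := h D a b hab
    exact isTightAlongMesh_of_isTightMeasureSet_image
      (Y := fun δ (γ : SAW.DomainSAW D.carrier δ (a δ) (b δ)) => γ.curve)
      (P := fun δ => SAW.law D.carrier δ (a δ) (b δ))
      (Eventually.of_forall fun δ => SAW.aemeasurable_curve D.carrier δ (a δ) (b δ)) hδ₀ hT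
  · intro h
    have h' : SAWLeftRightFKG.EventualTight := h
    exact TightOfShellCrossing_proof
      (sawTraversalBound_iff_shellCrossingBound.1 (sawTraversalBound_of_eventualTight h'))

/-- **stmt-1880 ⟺ stmt-1372**: `SAWTraversalBound` is equivalent to route `SAWRenewalTightness`'s
target-form eventual tightness (`∃ δ₀`, `IsTightMeasureSet` of the push-forward critical SAW laws
over `δ ∈ (0, δ₀]`). [folklore] -/
theorem sawTraversalBound_iff_renewalEventualTight :
    SAWTotalPositivity.SAWTraversalBound ↔ SAWRenewalTightness.EventualTight :=
  (sawTraversalBound_iff_eventualTight :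
      SAWTotalPositivity.SAWTraversalBound ↔ SAWTotalPositivity.EventualTight).trans
    renewalEventualTight_iff_eventualTight.symm

end Summit.CriticalPhenomena.SAWScalingLimit.Theorems

end
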